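import Mathlib
import HarnessLib
import Summits.HubbardSuperconductivity.HubbardSuperconductivity.Theorems.KLProgrammeKLRegimeEngineV8E5CarrierSplit
import Summits.HubbardSuperconductivity.HubbardSuperconductivity.Theorems.KLProgrammeKLRegimeWickCrossContractionNorms

/-!
# Route `KLProgramme` — ENGINE child gen 8 (stmt-HubbardSuperconductivity-20437 `KLRegimeEngineV17F2`), SKELETON v2 class #3, (RA-U) SUPPLIER part 3b-iii:
# the READ-OUT glue — from the doors' pinned prescribed sums of `kernel (map E(F′) ·)` to the levelled currency
# `hubbardSectorKernelNorm F′ (prescribedTuples univ Ωe)` of (RA-U), in ANY output family; the carrier's bound modulo the three door outputs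
# (cell gate-hubbard-kl, seat p5 g11; form-agnostic w.r.t. E1's (RA-U-a′) word; serves E1's levelled born sizes at `F′ = klAnisoFamily` equally)

The one-step doors (…E5CarrierBlockStep, …E5CarrierDoors, …E5CarrierDoorsTrivialInput; E1's …EngineTowerBlockStepLev) conclude with PINNED PRESCRIBED SUMS
`Σ_{X″ : X″ p = w″, (X″ j).2 = τ″ j ∀ j ∈ J} ‖kernel (map E(F′) T) (m+1) X″‖` (`p ∉ J`), whereas the levelled rows ((RA-U) = `E5CarrierLawAt`, E1's `klLevNormOf` /
`LevelsUMixedAt`) read `hubbardSectorKernelNorm L M β F′ (prescribedTuples univ Ωe) T` = `sup_{p,s,x} sectorLegSum`.  The dictionary is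
`pinnedSum_prod_eq_sectorLegSum_prescribed` (…WickCrossContractionNorms §3) + `kernel_map_sectorAnalysis`: at the pin `(p; x, s)` the leg sum over
`prescribedTuples univ Ωe` is `ε^m ×` the pinned sum with `J_p(Ωe) = {j ≠ p : Ωe j prescribed}`, `τ″ j = (Ωe j).getD s`, `w″ = (x, s)` — a SUB-sum of the door's
(the door does not constrain the pinned leg's own prescription).  Hence:

* §1 **`hubbardSectorKernelNorm_prescribed_le_of_pinned`** — ANY family `F′`, ANY `T`, ANY prescription `Ωe` of degree `m+1`: if for every pin `(p, w″)` the
  pinned sum prescribed on `J_p(Ωe)` is `≤ R` (`0 ≤ R`), then `‖T‖_{F′, prescribedTuples univ Ωe} ≤ ε^m·R` (`ε = imagTimeWeight β M`);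
  `card_pinCompl_prescribed_le` (`#J_p(Ωe) ≤ levelCount Ωe`) and `card_pinCompl_prescribed_add` (`#J_p(Ωe) + [Ωe p prescribed] = levelCount Ωe`) for the
  gain bookkeeping;
* §2 **`hubbardSectorKernelNorm_klE5Carrier_prescribed_le`** — the (RA-U) read-out modulo the three door outputs: with pinned-sum bounds `R₂, R₃, R₄` (uniform
  over the pins, prescriptions `J_p(Ωe)`) for `e^{Δ_{C∞}}V − V`, `I_Λ`, `e^{Δ_D}I_Λ − I_Λ` in the output family `F′`,
  `‖W_Λ‖_{F′,Ωe} ≤ ‖V‖_{F′,Ωe} + ε^m·(R₂ + R₃ + R₄)` (…E5CarrierSplit §4 + §1); any dressing `κ`, any input `V`.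
Part 4 (after E1's (RA-U-a′)/(Q-E1-λ) word) plugs the door right sides of …E5CarrierDoors(TrivialInput) as `R₂, R₃, R₄` and sums them into
`E5CarrierLawAt` with E1's kit.  Pure composition; no definitions, no named facts; nothing about the model's sizes is asserted; nothing asserts superconductivity.
-/

noncomputable section

namespace Summit.HubbardSuperconductivity.HubbardSuperconductivity.Theorems.KLRegimeSplit

set_option linter.dupNamespace false -- summit = problem name (single-conjunct summit), D-0017

open Real Finset Literature.MathematicalPhysics.QuantumLattice Literature.Probability.LatticeModels GrassmannAlgebra Matrix
open Literature.MathematicalPhysics.QuantumLattice.FermiRG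
open Summit.HubbardSuperconductivity.HubbardSuperconductivity.Theorems.KLProgrammeLegKernels
open Summit.HubbardSuperconductivity.HubbardSuperconductivity.Theorems.KLRegimeWick
open Summit.HubbardSuperconductivity.HubbardSuperconductivity.Theorems.EngineV8
open Summit.HubbardSuperconductivity.HubbardSuperconductivity.Theorems.TwoPointAssembly
open Summit.HubbardSuperconductivity.HubbardSuperconductivity.Theorems.TorusFourierL2
open Summit.HubbardSuperconductivity.HubbardSuperconductivity.Theorems.DispersionFlow

/-! ## §1 From pinned prescribed sums to the levelled sectorised norm -/

section Readout

variable {L M N' : ℕ} [NeZero L]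

omit [NeZero L] in
/-- The door's prescribed set at the pin `p` for a prescription `Ωe`: `J_p(Ωe) = {j ≠ p : Ωe j prescribed}` has at most `levelCount Ωe` elements. [folklore] -/
theorem card_pinCompl_prescribed_le {m : ℕ} (Ωe : Fin (m + 1) → Option (SectorLeg N')) (p : Fin (m + 1)) :
    (univ.filter fun j : Fin (m + 1) => j ≠ p ∧ (Ωe j).isSome).card ≤ levelCount Ωe := by
  unfold levelCount
  exact card_le_card (fun j hj => by
    rw [mem_filter] at hj ⊢
    exact ⟨hj.1, hj.2.2⟩)

omit [NeZero L] in
/-- … exactly: `#J_p(Ωe) + [Ωe p prescribed] = levelCount Ωe`. [folklore] -/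
theorem card_pinCompl_prescribed_add {m : ℕ} (Ωe : Fin (m + 1) → Option (SectorLeg N')) (p : Fin (m + 1)) :
    (univ.filter fun j : Fin (m + 1) => j ≠ p ∧ (Ωe j).isSome).card + (if (Ωe p).isSome then 1 else 0) = levelCount Ωe := by
  classical
  unfold levelCount
  have hsplit := (card_filter_add_card_filter_not (s := univ.filter fun j : Fin (m + 1) => (Ωe j).isSome) (fun j => j ≠ p))
  rw [filter_filter, filter_filter] at hsplit
  have h1 : (univ.filter fun j : Fin (m + 1) => (Ωe j).isSome ∧ j ≠ p) = univ.filter fun j : Fin (m + 1) => j ≠ p ∧ (Ωe j).isSome :=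
    filter_congr fun j _ => and_comm
  have h2 : (univ.filter fun j : Fin (m + 1) => (Ωe j).isSome ∧ ¬ j ≠ p).card = if (Ωe p).isSome then 1 else 0 := by
    split_ifs with hp
    · rw [card_eq_one]
      refine ⟨p, ?_⟩
      ext j
      simp only [mem_filter, mem_univ, true_and, not_not, mem_singleton]
      exact ⟨fun h => h.2, fun h => ⟨h ▸ hp, h⟩⟩
    · rw [card_eq_zero, filter_eq_empty_iff]
      intro j _ h
      exact hp (not_not.1 h.2 ▸ h.1)
  rw [h1, h2] at hsplit
  exact hsplit

/-- **FROM PINNED PRESCRIBED SUMS TO THE LEVELLED SECTORISED NORM**, any family `F′`, any Grassmann element `T`, any prescription `Ωe` of degree `m+1`: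
if at every pin `(p, w″)` the door-shaped pinned sum of `kernel (map E(F′) T) (m+1)` with the other legs prescribed on `J_p(Ωe) = {j ≠ p : Ωe j prescribed}`
to `τ″ j = (Ωe j).getD w″.2` is `≤ R` (`0 ≤ R`), then `hubbardSectorKernelNorm L M β F′ (prescribedTuples univ Ωe) T ≤ (imagTimeWeight β M)^m · R`.
(`pinnedSum_prod_eq_sectorLegSum_prescribed` + `kernel_map_sectorAnalysis`; the leg sum at `(p; x, s)` is a sub-sum of the door's pinned sum at `w″ = (x, s)`.)
[cite: BenfattoGiulianiMastropietro2006, §2.8 (2.76)-(2.77)] -/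
theorem hubbardSectorKernelNorm_prescribed_le_of_pinned {β : ℝ} (hβ : 0 ≤ β) (F' : Fin N' → FreqMomentum L M → ℂ) (T : HubbardGrassmann L M)
    {m : ℕ} (Ωe : Fin (m + 1) → Option (SectorLeg N')) {R : ℝ} (hR : 0 ≤ R)
    (h : ∀ (p : Fin (m + 1)) (w'' : SpaceTimeIdx L M × SectorLeg N'),
      ∑ X'' ∈ univ.filter (fun X'' : Fin (m + 1) → SpaceTimeIdx L M × SectorLeg N' =>
          X'' p = w'' ∧ ∀ j ∈ univ.filter (fun j : Fin (m + 1) => j ≠ p ∧ (Ωe j).isSome), (X'' j).2 = (Ωe j).getD w''.2),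
        ‖kernel ℂ (ExteriorAlgebra.map (Matrix.toLin' (sectorAnalysisMatrix L M β F')) T) (m + 1) X''‖ ≤ R) :
    hubbardSectorKernelNorm L M β F' (prescribedTuples univ Ωe) T ≤ imagTimeWeight β M ^ m * R := by
  classical
  have hε : 0 ≤ imagTimeWeight β M := imagTimeWeight_nonneg hβ M
  rw [hubbardSectorKernelNorm_def]
  refine sectorisedKernelNorm_le_of_forall_le (mul_nonneg (pow_nonneg hε m) hR) fun p s x => ?_
  rw [← pinnedSum_prod_eq_sectorLegSum_prescribed (imagTimeWeight β M) (sectorisedKernel L M β F' T (m + 1)) p x s Ωe]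
  refine mul_le_mul_of_nonneg_left ?_ (pow_nonneg hε m)
  refine le_trans ?_ (h p (x, s))
  -- the prescribed leg sum is a sub-sum of the door's pinned sum, term by term the same number
  refine le_trans (le_of_eq (sum_congr rfl fun Y _ => ?_)) (sum_le_sum_of_subset_of_nonneg (fun Y hY => ?_) fun _ _ _ => norm_nonneg _)
  · rw [kernel_map_sectorAnalysis]
  · rw [mem_filter] at hY ⊢
    refine ⟨mem_univ _, hY.2.1, fun j hj => ?_⟩
    rw [mem_filter] at hj
    obtain ⟨t, ht⟩ := Option.isSome_iff_exists.1 hj.2.2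
    rw [ht, Option.getD_some]
    exact hY.2.2 j t (by rw [ht]; exact Option.mem_some_iff.2 rfl)

end Readout

/-! ## §2 The carrier's levelled norm modulo the three door outputs -/

section Carrier

variable {L M N' : ℕ} [NeZero L] {β : ℝ} (hβ : 0 ≤ β) (μ : ℝ) (K : TrigPolyC4v) (n₀ : ℕ) (κ : FreqMomentum L M × Fin 2 → ℂ)
include hβ

/-- **THE (RA-U) READ-OUT MODULO THE DOORS**: in ANY output family `F′` and for ANY prescription `Ωe` of degree `m+1`, if the door-shaped pinned sums (other legs
prescribed on `J_p(Ωe)`) of the three born terms of the carrier split — `e^{Δ_{C∞}}V − V`, `I_Λ = effAction C_Λ V − e^{Δ_{C_Λ}}V`, `e^{Δ_D}I_Λ − I_Λ`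
(`C∞ = klE5Total`, `C_Λ = klE5DressedSlice … Λ`, `D = C∞ − C_Λ`) — are `≤ R₂, R₃, R₄` uniformly over the pins, then
`‖W_Λ‖_{F′,Ωe} ≤ ‖V‖_{F′,Ωe} + ε^m·(R₂ + R₃ + R₄)` (…E5CarrierSplit §4 + §1).  Any dressing `κ`, any input `V`; the `R`'s are the right sides of
…E5CarrierDoors / …E5CarrierDoorsTrivialInput read at `J = J_p(Ωe)`. [cite: BenfattoGiulianiMastropietro2006, §2.8 (2.80)-(2.84)] -/
theorem hubbardSectorKernelNorm_klE5Carrier_prescribed_le (V : HubbardGrassmann L M) (Λ : ℝ) (F' : Fin N' → FreqMomentum L M → ℂ)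
    {m : ℕ} (Ωe : Fin (m + 1) → Option (SectorLeg N')) {R₂ R₃ R₄ : ℝ} (hR₂ : 0 ≤ R₂) (hR₃ : 0 ≤ R₃) (hR₄ : 0 ≤ R₄)
    (h₂ : ∀ (p : Fin (m + 1)) (w'' : SpaceTimeIdx L M × SectorLeg N'),
      ∑ X'' ∈ univ.filter (fun X'' : Fin (m + 1) → SpaceTimeIdx L M × SectorLeg N' =>
          X'' p = w'' ∧ ∀ j ∈ univ.filter (fun j : Fin (m + 1) => j ≠ p ∧ (Ωe j).isSome), (X'' j).2 = (Ωe j).getD w''.2),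
        ‖kernel ℂ (ExteriorAlgebra.map (Matrix.toLin' (sectorAnalysisMatrix L M β F'))
          (gaussConv ℂ (klE5Total L M β μ K n₀ κ) V - V)) (m + 1) X''‖ ≤ R₂)
    (h₃ : ∀ (p : Fin (m + 1)) (w'' : SpaceTimeIdx L M × SectorLeg N'),
      ∑ X'' ∈ univ.filter (fun X'' : Fin (m + 1) → SpaceTimeIdx L M × SectorLeg N' =>
          X'' p = w'' ∧ ∀ j ∈ univ.filter (fun j : Fin (m + 1) => j ≠ p ∧ (Ωe j).isSome), (X'' j).2 = (Ωe j).getD w''.2),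
        ‖kernel ℂ (ExteriorAlgebra.map (Matrix.toLin' (sectorAnalysisMatrix L M β F'))
          (effAction ℂ (klE5DressedSlice L M β μ K n₀ κ Λ) V - gaussConv ℂ (klE5DressedSlice L M β μ K n₀ κ Λ) V)) (m + 1) X''‖ ≤ R₃)
    (h₄ : ∀ (p : Fin (m + 1)) (w'' : SpaceTimeIdx L M × SectorLeg N'),
      ∑ X'' ∈ univ.filter (fun X'' : Fin (m + 1) → SpaceTimeIdx L M × SectorLeg N' =>
          X'' p = w'' ∧ ∀ j ∈ univ.filter (fun j : Fin (m + 1) => j ≠ p ∧ (Ωe j).isSome), (X'' j).2 = (Ωe j).getD w''.2),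
        ‖kernel ℂ (ExteriorAlgebra.map (Matrix.toLin' (sectorAnalysisMatrix L M β F'))
          (gaussConv ℂ (klE5Total L M β μ K n₀ κ - klE5DressedSlice L M β μ K n₀ κ Λ)
              (effAction ℂ (klE5DressedSlice L M β μ K n₀ κ Λ) V - gaussConv ℂ (klE5DressedSlice L M β μ K n₀ κ Λ) V) -
            (effAction ℂ (klE5DressedSlice L M β μ K n₀ κ Λ) V - gaussConv ℂ (klE5DressedSlice L M β μ K n₀ κ Λ) V))) (m + 1) X''‖ ≤ R₄) :
    hubbardSectorKernelNorm L M β F' (prescribedTuples univ Ωe) (klE5Carrier L M β μ K n₀ κ V Λ) ≤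
      hubbardSectorKernelNorm L M β F' (prescribedTuples univ Ωe) V + imagTimeWeight β M ^ m * (R₂ + R₃ + R₄) := by
  have e2 := hubbardSectorKernelNorm_prescribed_le_of_pinned hβ F' _ Ωe hR₂ h₂
  have e3 := hubbardSectorKernelNorm_prescribed_le_of_pinned hβ F' _ Ωe hR₃ h₃
  have e4 := hubbardSectorKernelNorm_prescribed_le_of_pinned hβ F' _ Ωe hR₄ h₄
  refine (hubbardSectorKernelNorm_klE5Carrier_le_four hβ μ K n₀ κ V Λ F' (prescribedTuples univ Ωe)).trans ?_
  rw [mul_add, mul_add]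
  linarith

end Carrier

end Summit.HubbardSuperconductivity.HubbardSuperconductivity.Theorems.KLRegimeSplit

end
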